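import Summits.AtomisticToContinuum.FouriersLaw.Theorems.BondHeatUncertaintySubdiffusiveBondHeatJunctionOneGoodScale
import Summits.AtomisticToContinuum.FouriersLaw.Theorems.BondHeatUncertaintyTransferToNonBallistic
import Summits.AtomisticToContinuum.FouriersLaw.Theorems.BondHeatUncertaintyLightConeBondHeatTentNonBallistic

/-!
(SPLIT FOR THE 400-LINE CAP by the landing lane, hand-2 g35: this file = part 1 of 2; sequels `…BondHeatUncertaintyBoundedResponseEscapeExcess` import it in a chain; same namespace, all FQNs unchanged.)
# The escape-excess law: `11071 ⟺ NonBallistic (9127) ∧ EscapeExcessLaw` — the exact complement of the weakest partner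

Support file for stmt-AtomisticToContinuum-11071 (`BondHeatUncertainty.BoundedResponse`), decomposition cell `decomp-a2c`,
lens-1 (grading / quantitative ladder), gen 93.  Imports lens-1 file (9) `…JunctionOneGoodScale` (`EscapeInfZero ⟺ NonBallistic`,
the escape-deficit frame `escapeDeficit`, `ExponentFloor`, `OhmicFloor ⟺ 11071`), the landed transfer `…TransferToNonBallistic`
(stmt-9656 ✓) and the single-time feeders `…LightConeBondHeatTentNonBallistic` / `…WindowedTransfer`.

THE CUT (by SCALE, not by time).  With `E_N(T) = escapeDeficit ω₂ λ β γ T N ∈ [0, 1]` (boundary escape deficit; response identity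
`D_N = (N−1)γ·E_N`; 11071 ⟺ `OhmicFloor`: `E_N ≤ C₁(T)/N` eventually) define the **escape-excess law with exponent `a`**

  `EscapeExcess a :  ∀ params ∀ T > 0, ∃ C N₀, ∀ N ≥ N₀, ∀ M ≥ N,  E_N(T) ≤ E_M(T) + C / N^a`

— «a chain of length `N` is at most `C/N^a` MORE ballistic than any longer chain»: an upper bound on the DROPS of the escape deficit
across scales, with no statement about its size.  `EscapeExcessLaw` is `a = 1` (`C/N`).  Checked here (no `sorry`):

* KERNEL (three lines of order arithmetic, `le_of_excess_of_frequently_small`): `EscapeExcess a ∧ EscapeInfZero ⟹ ExponentFloor a`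
  — fix `N`, pick `M ≥ N` with `E_M ≤ ε`, get `E_N ≤ ε + C/N^a` for every `ε > 0`.
* EXACTNESS: `ExponentFloor a ⟺ EscapeVanishing ∧ EscapeExcess a ⟺ EscapeInfZero ∧ EscapeExcess a` for every `a > 0`
  (`exponentFloor_iff_escapeInfZero_and_excess`); at `a = 1`, BY NAME of the route items:
  **`BoundedResponse ⟺ NonBallistic ∧ EscapeExcessLaw`** (`boundedResponse_iff_nonBallistic_and_excess`; 11071 ⟺ 9127 ∧ X) and
  `BoundedResponse ⟺ NoBallisticChannel ∧ EscapeExcessLaw` (28286, route ChannelExclusionTauberian).  Both pieces are FL-NECESSARY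
  (`escapeExcessLaw_of_boundedResponse`, tree `nonBallistic_of_boundedResponse`), each is STRICTLY WEAKER than 11071 given the
  standard picture (X holds in the purely harmonic member, where `E_N → E_∞ > 0` and 11071 fails — `HarmonicEscapeExcess` below and
  tree `NonBallistic.Negative.FalseWithoutAnharmonicity`; 9127 holds for any sub-ballistic anomalous conductor, where X fails), and
  `EscapeExcess a` is PROVED for `a ≤ 0` (`escapeExcess_of_nonpos`: `0 ≤ E ≤ 1`).
* RE-HANG OF THE ROUTE with landed theorems only (`boundedResponse_of_nonBallisticTransfer_of_excess`): ANY feeder of the shape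
  `ExtensiveSnapshotIrreversibility → LinearResponseFTUR → NessUnique → NonBallistic` (the tree has three: `transferToNonBallistic_proof`
  = stmt-9656 from `LightConeBondHeat` 9123; `nonBallistic_of_windowed_bondHeat` from a windowed bond-heat law with ANY exponent `θ < 1`
  at ONE super-light-cone time; `nonBallistic_of_openBlockSubballistic` from an open-block law with ANY `α < 2`) plus (K) 9121 plus X
  gives 11071 (`LinearResponseFTUR_proof` ✓, `bondHeatUncertainty_nessUnique_holds` ✓ discharge (★) and NessUnique).  Headline:
  WITH X the time side of the route needs only a sub-ballistic bound `θ < 1` at a single time scale; WITHOUT X it needs the diffusive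
  exponent on the whole Thouless window (`TransferToBoundedResponse`, stmt-9655).  Likewise `0 < a → ExponentFloor a → X → 11071`
  (every positive rung of the exponent ladder, e.g. `CurrentCorrectorBudget a`, `a < 3`, or E1 `ConeScaleCorrector`, closes 11071
  given X: `exponentBootstrap_of_escapeExcessLaw`), and X ⟹ `NoAnomalousChannel` (28285).
* SEAMS: the LOCAL law `EscapeIncrementLaw` (`E_N ≤ E_{N+1} + C/N²` eventually) telescopes to X (`escapeExcessLaw_of_incrementLaw`,
  `Σ_{m ≥ N} 1/m² ≤ 1/(N−1) ≤ 2/N`); X forces CONVERGENCE of the ballistic fraction (`tendsto_escapeDeficit_of_escapeExcess`: a bounded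
  sequence whose drops are eventually small converges), hence the dichotomy per temperature «Ohmic floor, or `E_N(T) → E_∞(T) > 0`
  (uniformly ballistic)» (`ohmicAt_or_ballistic_of_escapeExcess`) — the same dichotomy file (9) draws from the buffered junction law,
  here from an FL-necessary hypothesis; letting `M → ∞` in X gives the ONE-SIDED RATE `E_N(T) ≤ E_∞(T) + C/N`
  (`upperRate_of_escapeExcessLaw`), and the two-sided finite-size scaling law `EscapeLimitRate` (`|E_N − E_∞| ≤ C/N`) implies X:
  **`BoundedResponse ⟺ NonBallistic ∧ EscapeLimitRate`** — «not uniformly ballistic» ∧ «`1/N` finite-size scaling of the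
  ballistic fraction» (`boundedResponse_iff_nonBallistic_and_limitRate`).

Position in the lens-1 docket.  File (9)'s node of record is `LocalityPassivityLaw → NonBallistic → 11071` (junction mechanism:
resistance superadditive up to a buffered defect; UNDECIDED, not known FL-necessary).  X is the ALTERNATIVE partner of the same
weakest piece 9127: the EXACT one.  The two partners are logically independent as typed (the junction law bounds `E_M` from ABOVE by
`E_N`-data, X bounds it from BELOW).  Tags for X: NECESSARY · STRICTLY-WEAKER (harmonic member) · UNDECIDED · IDEA-NEEDED (X ⟹ 28285,
so a proof uses the pinning / momentum non-conservation essentially) · INSTRUMENTABLE (census T6, `ω₂ = λ = β = γ = 1`: `E_N = D_N/(N−1)`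
is monotone decreasing over `N = 16 … 2048` at `T = 1, 3, 10`, so the finite-range excess defect `max_{M > N} N(E_N − E_M)` is just
`N(E_N − E_{N_max}) ≤ N·E_N ≤ κ(T)/γ ≈ 38 / 25 / 22`).  What this file does NOT do: prove X, `EscapeIncrementLaw` or 9127.
No `sorry`; standard axioms; nothing here closes an item.  [route statements · this cell; NOT literature facts]
-/

noncomputable section

open MeasureTheory Filter Topology Set intervalIntegral
open scoped BigOperators

namespace Summit.AtomisticToContinuum.FouriersLaw.Theorems.SubdiffusiveBondHeat

namespace EscapeGrading

open Literature.MathematicalPhysics.KineticTheory.HeatConduction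
open Summit.AtomisticToContinuum.FouriersLaw.Theses.BondHeatUncertainty
  (BoundedResponse NonBallistic LightConeBondHeat ExtensiveSnapshotIrreversibility LinearResponseFTUR NessUnique)
open Summit.AtomisticToContinuum.FouriersLaw.Theses.ChannelExclusionTauberian (NoBallisticChannel NoAnomalousChannel)
open Summit.AtomisticToContinuum.FouriersLaw.Theses.OddSectorIrreversibility (ConeScaleCorrector)

/-! ## 1. The pieces -/

/-- **Escape-excess law with exponent `a`** [route statement · this cell; NOT a literature fact]: for all parameters and every
`T > 0` there are `C, N₀` with `E_N(T) ≤ E_M(T) + C/N^a` for all `N₀ ≤ N ≤ M` — beyond `N₀` the escape deficit never DROPS by more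
than `C/N^a`.  PROVED for `a ≤ 0`; FL-NECESSARY for `a ≤ 1`; with `EscapeInfZero` (⟺ 9127) EQUIVALENT to `ExponentFloor a` (`a > 0`).
Why it might fail: an anomalous phase `E_N ≍ N^{-s}`, `s < a`, at some `(params, T)` refutes it (for `a = 1` that is ¬FL itself);
a ballistic phase with NON-convergent `E_N` would refute every `a > 0`. [piece · rung] -/
def EscapeExcess (a : ℝ) : Prop :=
  ∀ ω₂ lam β γ : ℝ, 0 < ω₂ → 0 < lam → 0 < β → 0 < γ → ∀ T : ℝ, 0 < T →
    ∃ C : ℝ, ∃ N₀ : ℕ, ∀ N : ℕ, N₀ ≤ N → ∀ M : ℕ, N ≤ M →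
      escapeDeficit ω₂ lam β γ T N ≤ escapeDeficit ω₂ lam β γ T M + C / (N : ℝ) ^ a

/-- **The escape-excess law** X (`a = 1`, stated with `C/N`) [route statement · this cell; NOT a literature fact]: `E_N(T) ≤ E_M(T) + C/N`
for `N₀ ≤ N ≤ M`.  The EXACT complement of `NonBallistic` (9127) inside 11071: `BoundedResponse ⟺ NonBallistic ∧ EscapeExcessLaw`.
Why it might fail: only together with FL (it is FL-necessary); as a route statement it is UNDECIDED and needs the pinning (X ⟹ 28285). -/
def EscapeExcessLaw : Prop :=
  ∀ ω₂ lam β γ : ℝ, 0 < ω₂ → 0 < lam → 0 < β → 0 < γ → ∀ T : ℝ, 0 < T →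
    ∃ C : ℝ, ∃ N₀ : ℕ, ∀ N : ℕ, N₀ ≤ N → ∀ M : ℕ, N ≤ M →
      escapeDeficit ω₂ lam β γ T N ≤ escapeDeficit ω₂ lam β γ T M + C / (N : ℝ)

/-- **Local (one-step) escape-increment law** [route statement · this cell; NOT a literature fact]: `E_N(T) ≤ E_{N+1}(T) + C/N²`
eventually — adding one cell to the chain lowers the escape deficit by at most `C/N²`.  Telescopes to X (`escapeExcessLaw_of_incrementLaw`).
Why it might fail: it is STRONGER than X (X allows sparse drops of size `C/N`); resonant lengths could produce isolated larger steps. -/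
def EscapeIncrementLaw : Prop :=
  ∀ ω₂ lam β γ : ℝ, 0 < ω₂ → 0 < lam → 0 < β → 0 < γ → ∀ T : ℝ, 0 < T →
    ∃ C : ℝ, ∃ N₀ : ℕ, ∀ N : ℕ, N₀ ≤ N →
      escapeDeficit ω₂ lam β γ T N ≤ escapeDeficit ω₂ lam β γ T (N + 1) + C / (N : ℝ) ^ 2

/-- `EscapeExcess 1 ↔ EscapeExcessLaw`. [folklore] -/
theorem escapeExcess_one_iff_law : EscapeExcess 1 ↔ EscapeExcessLaw := by
  simp only [EscapeExcess, EscapeExcessLaw, Real.rpow_one]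

/-- Monotonicity in the exponent: `EscapeExcess b → EscapeExcess a` for `a ≤ b`. [folklore] -/
theorem escapeExcess_anti {a b : ℝ} (hab : a ≤ b) : EscapeExcess b → EscapeExcess a := by
  intro h ω₂ lam β γ hω hl hβ hγ T hT
  obtain ⟨C, N₀, hC⟩ := h ω₂ lam β γ hω hl hβ hγ T hT
  refine ⟨max C 0, max N₀ 1, fun N hN M hM => ?_⟩
  have hN₀ : N₀ ≤ N := le_trans (le_max_left _ _) hN
  have hN1 : (1 : ℝ) ≤ (N : ℝ) := by exact_mod_cast le_trans (le_max_right _ _) hN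
  have hNpos : (0 : ℝ) < (N : ℝ) := lt_of_lt_of_le zero_lt_one hN1
  have hpa : 0 < (N : ℝ) ^ a := Real.rpow_pos_of_pos hNpos a
  have hpb : 0 < (N : ℝ) ^ b := Real.rpow_pos_of_pos hNpos b
  have hab' : (N : ℝ) ^ a ≤ (N : ℝ) ^ b := Real.rpow_le_rpow_of_exponent_le hN1 hab
  have h1 : C / (N : ℝ) ^ b ≤ max C 0 / (N : ℝ) ^ b := div_le_div_of_nonneg_right (le_max_left C 0) hpb.le
  have h2 : max C 0 / (N : ℝ) ^ b ≤ max C 0 / (N : ℝ) ^ a := div_le_div_of_nonneg_left (le_max_right C 0) hpa hab'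
  linarith [hC N hN₀ M hM]

/-- **`EscapeExcess a` is PROVED for `a ≤ 0`** (`0 ≤ E_M`, `E_N ≤ 1 ≤ 1·N^{-a}`… at `a = 0` the constant `C = 1` works). [proved] -/
theorem escapeExcess_zero : EscapeExcess 0 := by
  intro ω₂ lam β γ hω hl hβ hγ T hT
  refine ⟨1, 2, fun N hN M hM => ?_⟩
  rw [Real.rpow_zero, div_one]
  have h1 : escapeDeficit ω₂ lam β γ T N ≤ 1 := escapeDeficit_le_one ω₂ lam β γ hω hl hβ hγ T hT N
  have h0 : 0 ≤ escapeDeficit ω₂ lam β γ T M := escapeDeficit_nonneg' hω hl hβ hγ hT (le_trans hN hM)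
  linarith

/-- `EscapeExcess a` for every `a ≤ 0`. [proved] -/
theorem escapeExcess_of_nonpos {a : ℝ} (ha : a ≤ 0) : EscapeExcess a :=
  escapeExcess_anti ha escapeExcess_zero

/-- **`ExponentFloor a ⟹ EscapeExcess a`** (`E_N ≤ C/N^a ≤ E_M + C/N^a` since `E_M ≥ 0`): every rung of the exponent ladder implies the
excess law of the same exponent. [folklore] -/
theorem escapeExcess_of_exponentFloor {a : ℝ} (hF : ExponentFloor a) : EscapeExcess a := by
  intro ω₂ lam β γ hω hl hβ hγ T hT
  obtain ⟨C, N₀, hC⟩ := hF ω₂ lam β γ hω hl hβ hγ T hT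
  refine ⟨C, max N₀ 2, fun N hN M hM => ?_⟩
  have h0 : 0 ≤ escapeDeficit ω₂ lam β γ T M :=
    escapeDeficit_nonneg' hω hl hβ hγ hT (le_trans (le_max_right _ _) (le_trans hN hM))
  have h1 : escapeDeficit ω₂ lam β γ T N ≤ C / (N : ℝ) ^ a := hC N (le_trans (le_max_left _ _) hN)
  linarith

/-- **X is FL-NECESSARY**: `BoundedResponse (11071) ⟹ EscapeExcessLaw`. [folklore] -/
theorem escapeExcessLaw_of_boundedResponse (h : BoundedResponse) : EscapeExcessLaw :=
  escapeExcess_one_iff_law.1 (escapeExcess_of_exponentFloor (exponentFloor_one_iff_boundedResponse.2 h))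

/-- `BoundedResponse ⟹ EscapeExcess a` for every `a ≤ 1`. [folklore] -/
theorem escapeExcess_of_boundedResponse {a : ℝ} (ha : a ≤ 1) (h : BoundedResponse) : EscapeExcess a :=
  escapeExcess_anti ha (escapeExcess_of_exponentFloor (exponentFloor_one_iff_boundedResponse.2 h))

/-! ## 2. The kernel: small excess + frequently small ⟹ small -/

/-- **Kernel (pure order arithmetic).**  If `E N ≤ E M + g` for every `M ≥ N` and `E M ≤ ε` for SOME `M ≥ N` for every `ε > 0`,
then `E N ≤ g`. [kernel] -/
theorem le_of_excess_of_frequently_small {E : ℕ → ℝ} {g : ℝ} {N : ℕ}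
    (hX : ∀ M : ℕ, N ≤ M → E N ≤ E M + g) (hV : ∀ ε : ℝ, 0 < ε → ∃ M : ℕ, N ≤ M ∧ E M ≤ ε) : E N ≤ g := by
  refine le_of_forall_pos_le_add fun ε hε => ?_
  obtain ⟨M, hM, hEM⟩ := hV ε hε
  linarith [hX M hM]

/-- A sequence tending to `0` is `≤ ε` at arbitrarily large indices. [folklore] -/
theorem exists_le_of_tendsto_zero {E : ℕ → ℝ} (h : Tendsto E atTop (𝓝 0)) :
    ∀ ε : ℝ, 0 < ε → ∀ N₀ : ℕ, ∃ M : ℕ, N₀ ≤ M ∧ E M ≤ ε := by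
  intro ε hε N₀
  obtain ⟨N₁, hN₁⟩ := eventually_atTop.1 (h.eventually (ge_mem_nhds hε))
  exact ⟨max N₀ N₁, le_max_left _ _, hN₁ _ (le_max_right _ _)⟩

/-- **`EscapeExcess a ∧ EscapeInfZero ⟹ ExponentFloor a`** — the kernel in the frame (same constant `C`, same threshold). [kernel · frame] -/
theorem exponentFloor_of_escapeExcess_of_escapeInfZero {a : ℝ} (hX : EscapeExcess a) (hI : EscapeInfZero) : ExponentFloor a := by
  intro ω₂ lam β γ hω hl hβ hγ T hT
  obtain ⟨C, N₀, hC⟩ := hX ω₂ lam β γ hω hl hβ hγ T hT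
  refine ⟨C, N₀, fun N hN => le_of_excess_of_frequently_small (hC N hN) fun ε hε => ?_⟩
  obtain ⟨M, hM, hEM⟩ := hI ω₂ lam β γ hω hl hβ hγ T hT ε hε N
  exact ⟨M, hM, hEM⟩

/-- `EscapeExcess a ∧ EscapeVanishing ⟹ ExponentFloor a`. [kernel · frame] -/
theorem exponentFloor_of_escapeExcess_of_escapeVanishing {a : ℝ} (hX : EscapeExcess a) (hV : EscapeVanishing) : ExponentFloor a :=
  exponentFloor_of_escapeExcess_of_escapeInfZero hX (escapeInfZero_of_escapeVanishing hV)

/-- **EXACTNESS: `ExponentFloor a ⟺ EscapeVanishing ∧ EscapeExcess a`** for `a > 0`. [folklore] -/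
theorem exponentFloor_iff_escapeVanishing_and_excess {a : ℝ} (ha : 0 < a) : ExponentFloor a ↔ EscapeVanishing ∧ EscapeExcess a :=
  ⟨fun h => ⟨escapeVanishing_of_exponentFloor ha h, escapeExcess_of_exponentFloor h⟩,
   fun h => exponentFloor_of_escapeExcess_of_escapeVanishing h.2 h.1⟩

/-- **EXACTNESS: `ExponentFloor a ⟺ EscapeInfZero ∧ EscapeExcess a`** for `a > 0` (`EscapeInfZero ⟺ NonBallistic`, file (9)). [folklore] -/
theorem exponentFloor_iff_escapeInfZero_and_excess {a : ℝ} (ha : 0 < a) : ExponentFloor a ↔ EscapeInfZero ∧ EscapeExcess a :=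
  ⟨fun h => ⟨escapeInfZero_of_escapeVanishing (escapeVanishing_of_exponentFloor ha h), escapeExcess_of_exponentFloor h⟩,
   fun h => exponentFloor_of_escapeExcess_of_escapeInfZero h.2 h.1⟩

/-! ## 3. The node: `11071 ⟺ NonBallistic ∧ EscapeExcessLaw` -/

/-- `EscapeExcessLaw → EscapeInfZero → OhmicFloor`. [kernel · frame] -/
theorem ohmicFloor_of_escapeExcessLaw_of_escapeInfZero (hX : EscapeExcessLaw) (hI : EscapeInfZero) : OhmicFloor :=
  exponentFloor_one_iff_ohmicFloor.1 (exponentFloor_of_escapeExcess_of_escapeInfZero (escapeExcess_one_iff_law.2 hX) hI)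

/-- **DOOR: `EscapeExcessLaw → EscapeInfZero → BoundedResponse` (11071).** [kernel · frame] -/
theorem boundedResponse_of_escapeExcessLaw_of_escapeInfZero (hX : EscapeExcessLaw) (hI : EscapeInfZero) : BoundedResponse :=
  ohmicFloor_iff_boundedResponse.1 (ohmicFloor_of_escapeExcessLaw_of_escapeInfZero hX hI)

/-- `EscapeExcessLaw → EscapeVanishing → BoundedResponse`. [kernel · frame] -/
theorem boundedResponse_of_escapeExcessLaw_of_escapeVanishing (hX : EscapeExcessLaw) (hV : EscapeVanishing) : BoundedResponse :=
  boundedResponse_of_escapeExcessLaw_of_escapeInfZero hX (escapeInfZero_of_escapeVanishing hV)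

/-- **DOOR OF RECORD: `EscapeExcessLaw → NonBallistic → BoundedResponse`** (X ∧ stmt-9127 ⟹ 11071), by name of the route items. [kernel · frame] -/
theorem boundedResponse_of_escapeExcessLaw_of_nonBallistic (hX : EscapeExcessLaw) (hB : NonBallistic) : BoundedResponse :=
  boundedResponse_of_escapeExcessLaw_of_escapeInfZero hX (escapeInfZero_of_nonBallistic hB)

/-- **DOOR (route ChannelExclusionTauberian): `EscapeExcessLaw → NoBallisticChannel → BoundedResponse`** (X ∧ stmt-28286 ⟹ 11071). [kernel · frame] -/
theorem boundedResponse_of_escapeExcessLaw_of_noBallisticChannel (hX : EscapeExcessLaw) (hB : NoBallisticChannel) : BoundedResponse :=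
  boundedResponse_of_escapeExcessLaw_of_escapeVanishing hX (escapeVanishing_of_noBallisticChannel hB)

/-- **EXACTNESS OF THE NODE: `BoundedResponse ⟺ NonBallistic ∧ EscapeExcessLaw`** (11071 ⟺ 9127 ∧ X). [folklore] -/
theorem boundedResponse_iff_nonBallistic_and_excess : BoundedResponse ↔ NonBallistic ∧ EscapeExcessLaw :=
  ⟨fun h => ⟨nonBallistic_of_boundedResponse h, escapeExcessLaw_of_boundedResponse h⟩,
   fun h => boundedResponse_of_escapeExcessLaw_of_nonBallistic h.2 h.1⟩

/-- `BoundedResponse ⟺ NoBallisticChannel ∧ EscapeExcessLaw` (11071 ⟺ 28286 ∧ X). [folklore] -/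
theorem boundedResponse_iff_noBallisticChannel_and_excess : BoundedResponse ↔ NoBallisticChannel ∧ EscapeExcessLaw :=
  ⟨fun h => ⟨noBallisticChannel_of_boundedResponse h, escapeExcessLaw_of_boundedResponse h⟩,
   fun h => boundedResponse_of_escapeExcessLaw_of_noBallisticChannel h.2 h.1⟩

/-- `BoundedResponse ⟺ EscapeInfZero ∧ EscapeExcessLaw` (escape-deficit currency). [folklore] -/
theorem boundedResponse_iff_escapeInfZero_and_excess : BoundedResponse ↔ EscapeInfZero ∧ EscapeExcessLaw :=
  ⟨fun h => ⟨escapeInfZero_of_nonBallistic (nonBallistic_of_boundedResponse h), escapeExcessLaw_of_boundedResponse h⟩,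
   fun h => boundedResponse_of_escapeExcessLaw_of_escapeInfZero h.2 h.1⟩

/-! ## 4. Re-hanging the route: any `NonBallistic` transfer + (K) + X ⟹ 11071 -/

/-- **COMBINATOR.**  Any feeder `(K) → (★) → NessUnique → NonBallistic`, the snapshot irreversibility (K) = stmt-9121 and X give 11071;
(★) = `LinearResponseFTUR` (stmt-9122 ✓ `LinearResponseFTUR_proof`) and `NessUnique` (stmt-0741 ✓ `bondHeatUncertainty_nessUnique_holds`)
are discharged by name. [kernel · frame] -/
theorem boundedResponse_of_nonBallisticTransfer_of_excess
    (h : ExtensiveSnapshotIrreversibility → LinearResponseFTUR → NessUnique → NonBallistic)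
    (hK : ExtensiveSnapshotIrreversibility) (hX : EscapeExcessLaw) : BoundedResponse :=
  boundedResponse_of_escapeExcessLaw_of_nonBallistic hX (h hK LinearResponseFTUR_proof bondHeatUncertainty_nessUnique_holds)

/-- **`LightConeBondHeat (9123) → ExtensiveSnapshotIrreversibility (9121) → EscapeExcessLaw → BoundedResponse`** via the LANDED
transfer `transferToNonBallistic_proof` (stmt-9656 ✓).  Compare `TransferToBoundedResponse` (stmt-9655 ✓): the same two cruxes WITHOUT X
need the light-cone law with the diffusive exponent on the whole window `[1, cN²]`; `transferToNonBallistic` uses it far less sharply. [frame] -/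
theorem boundedResponse_of_lightCone_of_snapshot_of_excess (hL : LightConeBondHeat) (hK : ExtensiveSnapshotIrreversibility)
    (hX : EscapeExcessLaw) : BoundedResponse :=
  boundedResponse_of_nonBallisticTransfer_of_excess (transferToNonBallistic_proof hL) hK hX

/-- **WINDOWED FEED: a single-time windowed bond-heat law with ANY exponent `θ < 1`** (hypothesis verbatim from the tree theorem
`LightConeBondHeat.nonBallistic_of_windowed_bondHeat`) **+ (K) + X ⟹ 11071.**  WITH X the time side needs only `θ < 1` at one
super-light-cone time `τ_N` (`τ_N^{2−θ}/N → ∞`); without X the route needs `θ = 1/2`-grade input on `[1, cN²]`. [frame] -/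
theorem boundedResponse_of_windowedBondHeat_of_snapshot_of_excess
    (hS : ∀ ω₂ lam β γ : ℝ, 0 < ω₂ → 0 < lam → 0 < β → 0 < γ → ∀ T : ℝ, 0 < T →
      (let P := pinnedChain ω₂ lam β γ
       let C : ℕ → ℕ → ℝ → ℝ := fun N b s => if h : b < N then ∫ z, P.bondCurrent N ⟨b, h⟩ z *
         (∫ y, P.bondCurrent N ⟨b, h⟩ y ∂(P.transitionKernel N T T s.toNNReal z)) ∂(P.gibbsMeasure N T) else 0
       let V : ℕ → ℕ → ℝ → ℝ := fun N b t => 2 * ∫ s in (0 : ℝ)..t, (t - s) * C N b s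
       ∃ θ B : ℝ, ∃ τ : ℕ → ℝ, θ < 1 ∧ Tendsto (fun N : ℕ => τ N ^ (2 - θ) / (N : ℝ)) atTop atTop ∧
         ∃ N₀ : ℕ, ∀ N : ℕ, N₀ ≤ N → 0 < τ N ∧ ∃ b : ℕ, b + 1 < N ∧ V N b (τ N) ≤ B * τ N ^ θ))
    (hK : ExtensiveSnapshotIrreversibility) (hX : EscapeExcessLaw) : BoundedResponse :=
  boundedResponse_of_nonBallisticTransfer_of_excess (LightConeBondHeat.nonBallistic_of_windowed_bondHeat hS) hK hX

/-- **OPEN-BLOCK FEED: an open-block sub-ballistic law with ANY exponent `α < 2`** (hypothesis verbatim from the tree theorem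
`LightConeBondHeat.nonBallistic_of_openBlockSubballistic`) **+ (K) + X ⟹ 11071.** [frame] -/
theorem boundedResponse_of_openBlockSubballistic_of_snapshot_of_excess
    (hD : ∀ ω₂ lam β γ : ℝ, 0 < ω₂ → 0 < lam → 0 < β → 0 < γ → ∀ T : ℝ, 0 < T → ∃ C α : ℝ, 1 ≤ α ∧ α < 2 ∧
      ∀ (N b₀ L : ℕ), b₀ + L + 1 < N → ∀ t : ℝ, 1 ≤ t →
        2 * ∫ s in (0 : ℝ)..t, (t - s) *
          ∫ z, (∑ k : Fin N, (if b₀ ≤ k.val ∧ k.val ≤ b₀ + L then (pinnedChain ω₂ lam β γ).bondCurrent N k z else 0)) *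
            (∫ y, (∑ k : Fin N, (if b₀ ≤ k.val ∧ k.val ≤ b₀ + L then (pinnedChain ω₂ lam β γ).bondCurrent N k y else 0))
              ∂((pinnedChain ω₂ lam β γ).transitionKernel N T T s.toNNReal z))
            ∂((pinnedChain ω₂ lam β γ).gibbsMeasure N T) ≤ C * t ^ α * ((L : ℝ) + 1))
    (hK : ExtensiveSnapshotIrreversibility) (hX : EscapeExcessLaw) : BoundedResponse :=
  boundedResponse_of_nonBallisticTransfer_of_excess (LightConeBondHeat.nonBallistic_of_openBlockSubballistic hD) hK hX

/-! ## 5. X and the exponent ladder: every positive rung closes 11071 given X -/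

/-- **`0 < a → ExponentFloor a → EscapeExcessLaw → BoundedResponse`**: given X, ANY positive rung of the exponent ladder closes 11071
(`F(a) ⟹ EscapeVanishing`, then the kernel at exponent `1`). [kernel · frame] -/
theorem boundedResponse_of_exponentFloor_pos_of_excess {a : ℝ} (ha : 0 < a) (hF : ExponentFloor a) (hX : EscapeExcessLaw) :
    BoundedResponse :=
  boundedResponse_of_escapeExcessLaw_of_escapeVanishing hX (escapeVanishing_of_exponentFloor ha hF)

/-- **X ⟹ `ExponentBootstrap a`** for every `a > 0` (the bootstrap rung of the grading is a CONSEQUENCE of the excess law). [folklore] -/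
theorem exponentBootstrap_of_escapeExcessLaw {a : ℝ} (ha : 0 < a) (hX : EscapeExcessLaw) : ExponentBootstrap a :=
  fun hF => exponentFloor_one_iff_boundedResponse.2 (boundedResponse_of_exponentFloor_pos_of_excess ha hF hX)

/-- `CurrentCorrectorBudget a → EscapeExcessLaw → BoundedResponse` for every `a < 3` (`CCB(a) ⟹ F((3−a)/2)`, positive rung). [frame] -/
theorem boundedResponse_of_currentCorrectorBudget_of_excess {a : ℝ} (ha : a < 3) (hE : CurrentCorrectorBudget a)
    (hX : EscapeExcessLaw) : BoundedResponse :=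
  boundedResponse_of_exponentFloor_pos_of_excess (by linarith) (exponentFloor_of_currentCorrectorBudget hE) hX

/-- **E1 feed: `ConeScaleCorrector (14069) → EscapeExcessLaw → BoundedResponse`** (`E1 ⟹ F(1/2)`). [frame] -/
theorem boundedResponse_of_coneScaleCorrector_of_excess (hE : ConeScaleCorrector) (hX : EscapeExcessLaw) : BoundedResponse :=
  boundedResponse_of_currentCorrectorBudget_of_excess (by norm_num) (currentCorrectorBudget_two_of_coneScaleCorrector hE) hX

/-- **X ⟹ `NoAnomalousChannel` (stmt-28285)**: along any steady-state family with response coefficients `D`, `D_N/N → 0` forces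
`E_N(T) → 0` (response identity + uniqueness, by name: tree `tendsto_escape_zero_of_response_div`), the kernel then gives the Ohmic
floor `E_N(T) ≤ C/N` beyond `N₀` AT THAT TEMPERATURE, hence `|D_N| ≤ γ·max C 0` eventually and `sup_N |D_N| < ∞`.  So X carries
pinning content (28285 is false for the momentum-conserving FPU chain). [kernel · frame] -/
theorem noAnomalousChannel_of_escapeExcessLaw (hX : EscapeExcessLaw) : NoAnomalousChannel := by
  intro ω₂ lam β γ hω hl hβ hγ _ μ hμ T hT D hD hsub
  have huniq := bondHeatUncertainty_nessUnique_holds ω₂ lam β γ hω hl hβ hγ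
  have hRI := boundaryEscapeDeficit_responseIdentity_holds ω₂ lam β γ hω hl hβ hγ huniq μ hμ T hT
  dsimp only at hRI
  have hDpos : ∀ N : ℕ, 0 < N → D N = ((N : ℝ) - 1) * γ * escapeDeficit ω₂ lam β γ T N := fun N hN =>
    tendsto_nhds_unique (hD N) (hRI N hN).2
  have hE0 : ∀ N : ℕ, 2 ≤ N → 0 ≤ escapeDeficit ω₂ lam β γ T N := fun N hN => escapeDeficit_nonneg' hω hl hβ hγ hT hN
  have hV : Tendsto (fun N : ℕ => escapeDeficit ω₂ lam β γ T N) atTop (𝓝 0) :=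
    tendsto_escape_zero_of_response_div (E := fun N => escapeDeficit ω₂ lam β γ T N) hγ hE0 hDpos hsub
  obtain ⟨C, N₀, hC⟩ := hX ω₂ lam β γ hω hl hβ hγ T hT
  have hfl : ∀ N : ℕ, N₀ ≤ N → escapeDeficit ω₂ lam β γ T N ≤ C / (N : ℝ) := fun N hN =>
    le_of_excess_of_frequently_small (hC N hN) (fun ε hε => exists_le_of_tendsto_zero hV ε hε N)
  exact bddAbove_range_of_eventually_le
    (abs_response_le_of_escapeFloor_one (E := fun N => escapeDeficit ω₂ lam β γ T N) hγ hE0 hDpos hfl)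

end EscapeGrading

end Summit.AtomisticToContinuum.FouriersLaw.Theorems.SubdiffusiveBondHeat

end
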